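import Literature.Analysis.FluidPDE.CaloricRemainderEnergyBound
import Literature.Analysis.FluidPDE.KatoRieszPressureSuitable
import Literature.Analysis.FluidPDE.SobolevWeakGradient
import Literature.Analysis.FluidPDE.WeakGradientSlicing
import Literature.Analysis.FluidPDE.WeakSpatialGradientSum
import Literature.Analysis.FluidPDE.SolenoidalL2Duality
import Literature.Analysis.FluidPDE.NSSereginMildCore
import Literature.Analysis.FluidPDE.CaloricLocalLerayLp
import Mathlib.Analysis.MeanInequalitiesPow
import HarnessLib

/-!
# Kato solutions with bounded data are in `L³` in space–time up to the final time

Analysis/FluidPDE proof file (theorems only) on the Calderón / Rusin–Šverák route to the far-field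
regularity of Kato's mild `L³` solution near the blow-up time
(`Literature.Analysis.FluidPDE.IsKatoSolutionOn.farField_bound`; W. Rusin, V. Šverák, J. Funct.
Anal. 260 (2011) = arXiv:0911.0500, §4 p. 6; C. P. Calderón, Trans. AMS 318 (1990), §1;
P. G. Lemarié-Rieusset, *The Navier–Stokes problem in the 21st century* (2016), Prop. 15.1).

Let `u` be a Kato solution on `[0, T)` (`IsKatoSolutionOn T ν u₀ u`) whose datum is essentially
bounded, `|u₀| ≤ M` a.e. Splitting `u = e + w`, `e = e^{νtΔ}ũ₀` with `ũ₀` the bounded representative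
of `u₀`, the energy bound of the remainder (`caloric_remainder_energy_bound_ae`, applied on every
interior slab `(0, S)` with the suitable structure of
`IsKatoSolutionOn.exists_rieszPressure_suitable_slab`; its constant is uniform in `S < T`) gives
`w ∈ L^∞_t L²_x ∩ L²_t Ḣ¹_x` up to `T`; slicing the weak gradient
(`HasWeakSpatialGradientOn.ae_hasWeakFDerivOn_slice`), the Gagliardo–Nirenberg–Sobolev inequality
(`eLpNorm_six_le_lintegral_frobeniusNormSq_weakGradient`) and Hölder's inequality
(`|w|³ = |w|^{3/2} · |w|^{3/2}`, exponents `4/3`, `4`) yield `∫₀ᵀ∫ |w|³ < ∞`, whence, with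
`‖e(t)‖₃ ≤ ‖u₀‖₃`, the main result `IsKatoSolutionOn.lintegral_enorm_cube_lt_top_of_ae_bounded`:

  `∫₀ᵀ ∫ |u|³ dx dt < ∞`.

(For an arbitrary Kato solution this is applied after a restart at a positive time, where the
solution is bounded.)

## Mathlib / tree search

Tree: `caloric_remainder_energy_bound_ae` (`CaloricRemainderEnergyBound.lean`),
`integrableOn_frobeniusNormSq_sub_fderiv_heatFlow_box` (`CaloricRemainderEnergyWindow.lean`),
`memLp_uncurry_heatFlow_strip` (`CaloricRemainderEnergyTested.lean`),
`IsKatoSolutionOn.exists_rieszPressure_suitable_slab` (`KatoRieszPressureSuitable.lean`),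
`eLpNorm_six_le_lintegral_frobeniusNormSq_weakGradient` (`SobolevWeakGradient.lean`),
`HasWeakSpatialGradientOn.ae_hasWeakFDerivOn_slice` (`WeakGradientSlicing.lean`),
`HasWeakSpatialGradientOn.add` (`WeakSpatialGradientSum.lean`),
`hasWeakSpatialGradientOn_of_hasFDerivAt` (`CaloricLocalLerayLp.lean`),
`IsWeaklyDivFree.congr_ae` (`SolenoidalL2Duality.lean`), `contDiffOn_uncurry_heatFlow`
(`KatoCaloricField.lean`), `IsKatoSolutionOn.memLp_initial`, `.isWeaklyDivFree_initial`,
`.continuousInLpOn`, `.initial`, `.memLp_three_strip`, `.aestronglyMeasurable`. Mathlib: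
`ENNReal.lintegral_mul_le_Lp_mul_Lq`, `ENNReal.rpow_add_le_mul_rpow_add_rpow`,
`setLIntegral_iUnion_of_directed`, `lintegral_prod`, `Measure.prod_restrict`.

## References

* W. Rusin, V. Šverák, J. Funct. Anal. 260 (2011) 879–891 = arXiv:0911.0500, §4 p. 6.
  [RusinSverak2011]
* P. G. Lemarié-Rieusset, *The Navier–Stokes problem in the 21st century*, CRC Press 2016,
  Prop. 15.1, proof of Thm. 14.7 pp. 516–518. [LemarieRieusset2016]
-/

noncomputable section

open MeasureTheory TopologicalSpace Set Function Filter Topology Metric Real InnerProductSpace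

open scoped ENNReal NNReal RealInnerProductSpace Laplacian

namespace Literature.Analysis.FluidPDE

/-! ### Tools -/

section Tools

/-- **Bounded representative of an essentially bounded field**: if `|v| ≤ M` a.e. then
`ṽ = v 1_{|v| ≤ M}` is bounded by `max M 0` everywhere and `ṽ = v` a.e. [folklore] -/
theorem exists_forall_norm_le_ae_eq {X F : Type*} [MeasurableSpace X] {μ : Measure X}
    [NormedAddCommGroup F] {v : X → F} {M : ℝ} (hv : ∀ᵐ x ∂μ, ‖v x‖ ≤ M) :
    ∃ w : X → F, (∀ x, ‖w x‖ ≤ max M 0) ∧ v =ᵐ[μ] w := by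
  classical
  refine ⟨fun x => if ‖v x‖ ≤ M then v x else 0, fun x => ?_, ?_⟩
  · show ‖(if ‖v x‖ ≤ M then v x else 0)‖ ≤ max M 0
    by_cases h : ‖v x‖ ≤ M
    · rw [if_pos h]; exact h.trans (le_max_left _ _)
    · rw [if_neg h, norm_zero]; exact le_max_right _ _
  · filter_upwards [hv] with x hx
    rw [if_pos hx]

/-- Hölder for the cube: `∫ |w|³ ≤ (∫ |w|²)^{3/4} (∫ |w|⁶)^{1/4}` (`|w|³ = |w|^{3/2} |w|^{3/2}`,
exponents `4/3` and `4`). [folklore] -/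
theorem lintegral_enorm_cube_le_interp {X F : Type*} [MeasurableSpace X] {μ : Measure X}
    [NormedAddCommGroup F] {w : X → F} (hw : AEStronglyMeasurable w μ) :
    ∫⁻ x, ‖w x‖ₑ ^ (3 : ℝ) ∂μ ≤
      (∫⁻ x, ‖w x‖ₑ ^ (2 : ℝ) ∂μ) ^ (3 / 4 : ℝ) * (∫⁻ x, ‖w x‖ₑ ^ (6 : ℝ) ∂μ) ^ (1 / 4 : ℝ) := by
  have hpq : (4 / 3 : ℝ).HolderConjugate 4 := Real.holderConjugate_iff.2 ⟨by norm_num, by norm_num⟩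
  have hf : AEMeasurable (fun x => ‖w x‖ₑ ^ (3 / 2 : ℝ)) μ := hw.enorm.pow_const _
  have h := ENNReal.lintegral_mul_le_Lp_mul_Lq μ hpq hf hf
  have e1 : ∀ x, (fun x => ‖w x‖ₑ ^ (3 / 2 : ℝ)) x * (fun x => ‖w x‖ₑ ^ (3 / 2 : ℝ)) x = ‖w x‖ₑ ^ (3 : ℝ) := by
    intro x
    show ‖w x‖ₑ ^ (3 / 2 : ℝ) * ‖w x‖ₑ ^ (3 / 2 : ℝ) = ‖w x‖ₑ ^ (3 : ℝ)
    rw [← ENNReal.rpow_add_of_nonneg _ _ (by norm_num) (by norm_num)]; norm_num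
  have e2 : ∀ x, (‖w x‖ₑ ^ (3 / 2 : ℝ)) ^ (4 / 3 : ℝ) = ‖w x‖ₑ ^ (2 : ℝ) := by
    intro x; rw [← ENNReal.rpow_mul]; norm_num
  have e3 : ∀ x, (‖w x‖ₑ ^ (3 / 2 : ℝ)) ^ (4 : ℝ) = ‖w x‖ₑ ^ (6 : ℝ) := by
    intro x; rw [← ENNReal.rpow_mul]; norm_num
  have e4 : (fun x => ((fun x => ‖w x‖ₑ ^ (3 / 2 : ℝ)) * fun x => ‖w x‖ₑ ^ (3 / 2 : ℝ)) x) =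
      fun x => ‖w x‖ₑ ^ (3 : ℝ) := funext fun x => e1 x
  rw [e4] at h
  simp_rw [e2, e3] at h
  refine h.trans (le_of_eq ?_)
  norm_num

end Tools

/-! ### The `L³` bound -/

section Main

variable {T ν : ℝ} {u₀ : (EuclideanSpace ℝ (Fin 3)) → (EuclideanSpace ℝ (Fin 3))} {u : ℝ → (EuclideanSpace ℝ (Fin 3)) → (EuclideanSpace ℝ (Fin 3))}

/-- Monotonicity in `S` of the energy constant of `caloric_remainder_energy_bound`. [folklore] -/
theorem energyConst_mono {ν M N S T : ℝ} (hν : 0 < ν) (hM : 0 ≤ M) (hN : 0 ≤ N) (hS : 0 ≤ S) (hST : S ≤ T) :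
    (M * N * S / ν) * (1 + (2 * (2 ^ ((3 : ℝ) / 2) * ν ^ (-(1 / 2 : ℝ)) * M) * (2 * S ^ ((1 : ℝ) / 2)))) *
        Real.exp ((2 * (2 ^ ((3 : ℝ) / 2) * ν ^ (-(1 / 2 : ℝ)) * M) * (2 * S ^ ((1 : ℝ) / 2)))) ≤
      (M * N * T / ν) * (1 + (2 * (2 ^ ((3 : ℝ) / 2) * ν ^ (-(1 / 2 : ℝ)) * M) * (2 * T ^ ((1 : ℝ) / 2)))) *
        Real.exp ((2 * (2 ^ ((3 : ℝ) / 2) * ν ^ (-(1 / 2 : ℝ)) * M) * (2 * T ^ ((1 : ℝ) / 2)))) := by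
  have hc : 0 ≤ 2 * (2 ^ ((3 : ℝ) / 2) * ν ^ (-(1 / 2 : ℝ)) * M) :=
    mul_nonneg two_pos.le (mul_nonneg (mul_nonneg (by positivity) (Real.rpow_nonneg hν.le _)) hM)
  have hsq : S ^ ((1 : ℝ) / 2) ≤ T ^ ((1 : ℝ) / 2) := Real.rpow_le_rpow hS hST (by norm_num)
  have hA : (2 * (2 ^ ((3 : ℝ) / 2) * ν ^ (-(1 / 2 : ℝ)) * M)) * (2 * S ^ ((1 : ℝ) / 2)) ≤
      (2 * (2 ^ ((3 : ℝ) / 2) * ν ^ (-(1 / 2 : ℝ)) * M)) * (2 * T ^ ((1 : ℝ) / 2)) :=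
    mul_le_mul_of_nonneg_left (by linarith) hc
  have hA0 : 0 ≤ (2 * (2 ^ ((3 : ℝ) / 2) * ν ^ (-(1 / 2 : ℝ)) * M)) * (2 * S ^ ((1 : ℝ) / 2)) :=
    mul_nonneg hc (by positivity)
  have h1 : M * N * S / ν ≤ M * N * T / ν := by
    rw [div_le_div_iff_of_pos_right hν]
    exact mul_le_mul_of_nonneg_left hST (mul_nonneg hM hN)
  have h0 : 0 ≤ M * N * T / ν := div_nonneg (mul_nonneg (mul_nonneg hM hN) (hS.trans hST)) hν.le
  have hAT0 : 0 ≤ (2 * (2 ^ ((3 : ℝ) / 2) * ν ^ (-(1 / 2 : ℝ)) * M)) * (2 * T ^ ((1 : ℝ) / 2)) := hA0.trans hA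
  refine mul_le_mul (mul_le_mul h1 (by linarith) (by linarith) h0) (Real.exp_le_exp.2 hA)
    (Real.exp_pos _).le (mul_nonneg h0 (by linarith))

/-- `D^{3/4} ≤ 1 + D` in `[0, ∞]` (a private copy of the tree's lemma of the same name in
`TaoFiniteEnergyLerayHopf.lean`, to keep the imports light). [folklore] -/
private theorem rpow_threeQuarters_le_one_add' (D : ℝ≥0∞) : D ^ (3 / 4 : ℝ) ≤ 1 + D := by
  rcases le_total D 1 with h | h
  · exact (ENNReal.rpow_le_one h (by norm_num)).trans le_self_add
  · exact ((ENNReal.rpow_le_rpow_of_exponent_le h (by norm_num : (3 / 4 : ℝ) ≤ 1)).trans_eq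
      (ENNReal.rpow_one D)).trans le_add_self

set_option maxHeartbeats 1600000 in
/-- **Kato solutions with essentially bounded data are in `L³((0,T) × ℝ³)`** (Rusin–Šverák 2011,
§4 p. 6: the remainder `v = u - e^{tΔ}u₀` lies in the energy class up to the blow-up time, hence —
by Sobolev and interpolation — in `L³` in space–time, and so does `u`; Calderón 1990, §1;
Lemarié-Rieusset 2016, Prop. 15.1). For `ν > 0`, a Kato solution `u` on `[0, T)`, `T > 0`, with
`|u₀| ≤ M` a.e., `∫₀ᵀ∫ |u|³ dx dt < ∞`. [cite: RusinSverak2011, §4 p. 6] -/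
theorem IsKatoSolutionOn.lintegral_enorm_cube_lt_top_of_ae_bounded (hν : 0 < ν)
    (hu : IsKatoSolutionOn T ν u₀ u) (hT : 0 < T) {M : ℝ} (hbd : ∀ᵐ x ∂(volume : Measure (EuclideanSpace ℝ (Fin 3))), ‖u₀ x‖ ≤ M) :
    ∫⁻ z in Ioo 0 T ×ˢ (univ : Set (EuclideanSpace ℝ (Fin 3))), ‖u z.1 z.2‖ₑ ^ (3 : ℝ) < ∞ := by
  -- ### the bounded representative of the datum
  obtain ⟨ũ₀, hMb, hae⟩ := exists_forall_norm_le_ae_eq hbd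
  set M' : ℝ := max M 0 with hM'
  have hM'0 : 0 ≤ M' := le_max_right _ _
  have hu₀3 : MemLp u₀ 3 volume := hu.memLp_initial hT
  have hũ₀3 : MemLp ũ₀ 3 volume := hu₀3.ae_eq hae
  have hdiv : IsWeaklyDivFree ũ₀ := (hu.isWeaklyDivFree_initial hT).congr_ae hae
  have hinit : u 0 =ᵐ[volume] ũ₀ := by rw [hu.initial]; exact hae
  have hN30 : 0 ≤ ∫ x, ‖ũ₀ x‖ ^ 3 := integral_nonneg fun _ => by positivity
  -- ### the free evolution and the remainder on the strip
  obtain ⟨he3, he3b⟩ := memLp_uncurry_heatFlow_strip hũ₀3 hν T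
  have hum : AEStronglyMeasurable (fun z : ℝ × (EuclideanSpace ℝ (Fin 3)) => u z.1 z.2)
      (volume.restrict (Ioo 0 T ×ˢ (univ : Set (EuclideanSpace ℝ (Fin 3))))) := hu.aestronglyMeasurable
  have hem : AEStronglyMeasurable (fun z : ℝ × (EuclideanSpace ℝ (Fin 3)) => heatFlow ũ₀ (ν * z.1) z.2)
      (volume.restrict (Ioo 0 T ×ˢ (univ : Set (EuclideanSpace ℝ (Fin 3))))) := he3.aestronglyMeasurable
  have hwm : AEStronglyMeasurable (fun z : ℝ × (EuclideanSpace ℝ (Fin 3)) => (u z.1 z.2 - heatFlow ũ₀ (ν * z.1) z.2))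
      (volume.restrict (Ioo 0 T ×ˢ (univ : Set (EuclideanSpace ℝ (Fin 3))))) := hum.sub hem
  have hsm : IsSmoothSpaceTimeOn (Ioi 0) fun t x => heatFlow ũ₀ (ν * t) x :=
    contDiffOn_uncurry_heatFlow hũ₀3 (by norm_num) hν
  -- ### constants
  set Kst : ℝ := ((M' * (∫ x, ‖ũ₀ x‖ ^ 3) * T / ν) * (1 + (2 * (2 ^ ((3 : ℝ) / 2) * ν ^ (-(1 / 2 : ℝ)) * M') * (2 * T ^ ((1 : ℝ) / 2)))) * Real.exp ((2 * (2 ^ ((3 : ℝ) / 2) * ν ^ (-(1 / 2 : ℝ)) * M') * (2 * T ^ ((1 : ℝ) / 2))))) with hKst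
  have hKst0 : 0 ≤ Kst := by positivity
  set K6 : ℝ≥0 := SNormLESNormFDerivOfEqConst (EuclideanSpace ℝ (Fin 3)) (volume : Measure (EuclideanSpace ℝ (Fin 3))) 2 with hK6
  set C₀ : ℝ≥0∞ := ENNReal.ofReal Kst ^ (3 / 4 : ℝ) * (K6 : ℝ≥0∞) ^ (3 / 2 : ℝ) with hC₀
  have hC₀top : C₀ ≠ ⊤ :=
    ENNReal.mul_ne_top (ENNReal.rpow_ne_top_of_nonneg (by norm_num) ENNReal.ofReal_ne_top)
      (ENNReal.rpow_ne_top_of_nonneg (by norm_num) ENNReal.coe_ne_top)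
  have hprodS : ∀ S : ℝ, (volume.restrict (Ioo 0 S ×ˢ (univ : Set (EuclideanSpace ℝ (Fin 3))))) =
      (volume.restrict (Ioo 0 S)).prod (volume : Measure (EuclideanSpace ℝ (Fin 3))) := fun S => by
    rw [show (volume : Measure (ℝ × (EuclideanSpace ℝ (Fin 3)))) = (volume : Measure ℝ).prod volume from rfl,
      ← Measure.prod_restrict, Measure.restrict_univ]
  -- ### the bound on every interior strip `(0, S) × ℝ³`
  have perS : ∀ S, 0 < S → S < T →
      ∫⁻ z in Ioo 0 S ×ˢ (univ : Set (EuclideanSpace ℝ (Fin 3))), ‖(u z.1 z.2 - heatFlow ũ₀ (ν * z.1) z.2)‖ₑ ^ (3 : ℝ) ≤ C₀ * (ENNReal.ofReal T + ENNReal.ofReal (Kst / ν)) := by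
    intro S hS hST
    obtain ⟨p, -, hp32, -, -, hsuit⟩ := hu.exists_rieszPressure_suitable_slab hν hS hST
    obtain ⟨G, hG, hG2, hLEI⟩ := hsuit.localEnergy
    have hNS := hsuit.distributional
    have hu3 := hu.memLp_three_strip hST
    have hcontS : ContinuousInLpOn (Ico 0 S) 3 u := hu.continuousInLpOn.mono (Ico_subset_Ico_right hST.le)
    have hKS : ((M' * (∫ x, ‖ũ₀ x‖ ^ 3) * S / ν) * (1 + (2 * (2 ^ ((3 : ℝ) / 2) * ν ^ (-(1 / 2 : ℝ)) * M') * (2 * S ^ ((1 : ℝ) / 2)))) * Real.exp ((2 * (2 ^ ((3 : ℝ) / 2) * ν ^ (-(1 / 2 : ℝ)) * M') * (2 * S ^ ((1 : ℝ) / 2))))) ≤ Kst := by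
      rw [hKst]; exact energyConst_mono hν hM'0 hN30 hS.le hST.le
    have hEB : ∀ t ∈ Ioo 0 S, (∫⁻ x, ‖u t x - heatFlow ũ₀ (ν * t) x‖ₑ ^ 2) ≤ ENNReal.ofReal Kst ∧
        ENNReal.ofReal ν * ∫⁻ z in Ioc 0 t ×ˢ (univ : Set (EuclideanSpace ℝ (Fin 3))), ENNReal.ofReal (frobeniusNormSq (G z.1 z.2 - fderiv ℝ (heatFlow ũ₀ (ν * z.1)) z.2)) ≤ ENNReal.ofReal Kst := by
      intro t ht
      obtain ⟨h1, h2⟩ := caloric_remainder_energy_bound_ae hν hS hM'0 hMb hũ₀3 hdiv hNS hG hG2 hLEI hu3 hp32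
        hcontS hinit ht
      exact ⟨h1.trans (ENNReal.ofReal_le_ofReal hKS), h2.trans (ENNReal.ofReal_le_ofReal hKS)⟩
    -- the dissipation on the whole strip `(0, S)`
    have hDS : ∫⁻ z in Ioo 0 S ×ˢ (univ : Set (EuclideanSpace ℝ (Fin 3))), ENNReal.ofReal (frobeniusNormSq (G z.1 z.2 - fderiv ℝ (heatFlow ũ₀ (ν * z.1)) z.2)) ≤ ENNReal.ofReal (Kst / ν) := by
      set tn : ℕ → ℝ := fun n => S * (((n : ℝ) + 1) / ((n : ℝ) + 2)) with htn
      have htn0 : ∀ n, 0 < tn n := fun n => by positivity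
      have htnS : ∀ n, tn n < S := fun n => by
        rw [htn]; dsimp only
        have : ((n : ℝ) + 1) / ((n : ℝ) + 2) < 1 := by rw [div_lt_one (by positivity)]; linarith
        nlinarith
      have hmono : Monotone tn := fun m n hmn => by
        rw [htn]; dsimp only
        refine mul_le_mul_of_nonneg_left ?_ hS.le
        rw [div_le_div_iff₀ (by positivity) (by positivity)]
        nlinarith [(Nat.cast_le.2 hmn : (m : ℝ) ≤ n)]
      have hdir : Directed (· ⊆ ·) fun n : ℕ => Ioc 0 (tn n) ×ˢ (univ : Set (EuclideanSpace ℝ (Fin 3))) :=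
        Monotone.directed_le fun m n hmn => prod_mono (Ioc_subset_Ioc_right (hmono hmn)) Subset.rfl
      have hU : (⋃ n : ℕ, Ioc 0 (tn n) ×ˢ (univ : Set (EuclideanSpace ℝ (Fin 3)))) = Ioo 0 S ×ˢ (univ : Set (EuclideanSpace ℝ (Fin 3))) := by
        rw [← iUnion_prod_const]
        congr 1
        refine subset_antisymm (iUnion_subset fun n => Ioc_subset_Ioo_right (htnS n)) fun r hr => ?_
        -- `r < S`: pick `n` with `tn n ≥ r`, i.e. `(n+1)/(n+2) ≥ r/S`
        obtain ⟨n, hn⟩ := exists_nat_gt (r / (S - r))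
        refine mem_iUnion.2 ⟨n, ⟨hr.1, ?_⟩⟩
        rw [htn]; dsimp only
        rw [div_lt_iff₀ (by linarith [hr.2])] at hn
        rw [mul_div_assoc', le_div_iff₀ (by positivity)]
        nlinarith [hr.1, hr.2]
      rw [← hU, setLIntegral_iUnion_of_directed _ hdir]
      refine iSup_le fun n => ?_
      have h := (hEB (tn n) ⟨htn0 n, htnS n⟩).2
      rw [ENNReal.ofReal_div_of_pos hν]
      refine (ENNReal.le_div_iff_mul_le (Or.inl (ENNReal.ofReal_pos.2 hν).ne') (Or.inl ENNReal.ofReal_ne_top)).2 ?_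
      rw [mul_comm]; exact h
    -- the weak gradient of the remainder and its slices
    have hneg : HasWeakSpatialGradientOn (slab (EuclideanSpace ℝ (Fin 3)) (Ioo 0 S) isOpen_Ioo) (fun t x => -heatFlow ũ₀ (ν * t) x)
        (fun t x => -fderiv ℝ (heatFlow ũ₀ (ν * t)) x) := by
      refine hasWeakSpatialGradientOn_of_hasFDerivAt (S := Ioi 0) (fun z hz => ⟨(mem_slab.1 hz).1, mem_univ _⟩)
        ?_ ?_ (fun t ht x => ?_)
      · exact hsm.continuousOn.neg
      · exact (hsm.fderiv_slice isOpen_Ioi.uniqueDiffOn).continuousOn.neg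
      · exact (((hsm.contDiff_slice ht).differentiable (by simp)) x).hasFDerivAt.neg
    have hGw : HasWeakSpatialGradientOn (slab (EuclideanSpace ℝ (Fin 3)) (Ioo 0 S) isOpen_Ioo) (fun t x => (u t x - heatFlow ũ₀ (ν * t) x))
        (fun t x => G t x - fderiv ℝ (heatFlow ũ₀ (ν * t)) x) := by
      have h := hG.add hneg
      simp only [← sub_eq_add_neg] at h
      exact h
    have hslab : (slab (EuclideanSpace ℝ (Fin 3)) (Ioo 0 S) isOpen_Ioo) =
        (⟨Ioo 0 S ×ˢ ((⊤ : Opens (EuclideanSpace ℝ (Fin 3))) : Set (EuclideanSpace ℝ (Fin 3))), isOpen_Ioo.prod (⊤ : Opens (EuclideanSpace ℝ (Fin 3))).isOpen⟩ : Opens (ℝ × (EuclideanSpace ℝ (Fin 3)))) := by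
      ext z
      simp
    rw [hslab] at hGw
    have hslice := hGw.ae_hasWeakFDerivOn_slice
    -- the bound on the slices, a.e. in `t`
    have hx : ∀ᵐ t ∂(volume.restrict (Ioo 0 S)),
        ∫⁻ x, ‖(u t x - heatFlow ũ₀ (ν * t) x)‖ₑ ^ (3 : ℝ) ≤ C₀ * (1 + ∫⁻ x, ENNReal.ofReal (frobeniusNormSq (G t x - fderiv ℝ (heatFlow ũ₀ (ν * t)) x))) := by
      filter_upwards [hslice, ae_restrict_mem measurableSet_Ioo] with t ht htm
      set D : ℝ≥0∞ := ∫⁻ x, ENNReal.ofReal (frobeniusNormSq (G t x - fderiv ℝ (heatFlow ũ₀ (ν * t)) x)) with hD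
      have hw_t : AEStronglyMeasurable (fun x => (u t x - heatFlow ũ₀ (ν * t) x)) volume :=
        (hu.memLp ⟨htm.1.le, htm.2.trans hST⟩).aestronglyMeasurable.sub
          (memLp_heatFlow_holds hũ₀3 (by norm_num) (mul_nonneg hν.le htm.1.le)).aestronglyMeasurable
      have h2 : ∫⁻ x, ‖(u t x - heatFlow ũ₀ (ν * t) x)‖ₑ ^ (2 : ℝ) ≤ ENNReal.ofReal Kst := by
        simp_rw [ENNReal.rpow_two]; exact (hEB t htm).1
      have h2' : eLpNorm (fun x => (u t x - heatFlow ũ₀ (ν * t) x)) 2 volume < ∞ := by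
        rw [eLpNorm_eq_lintegral_rpow_enorm_toReal two_ne_zero ENNReal.ofNat_ne_top, ENNReal.toReal_ofNat]
        exact ENNReal.rpow_lt_top_of_nonneg (by norm_num) (ne_top_of_le_ne_top ENNReal.ofReal_ne_top h2)
      have h6 : eLpNorm (fun x => (u t x - heatFlow ũ₀ (ν * t) x)) 6 volume ≤ (K6 : ℝ≥0∞) * D ^ (1 / 2 : ℝ) :=
        eLpNorm_six_le_lintegral_frobeniusNormSq_weakGradient finrank_euclideanSpace_fin ht h2'
      have h6' : ∫⁻ x, ‖(u t x - heatFlow ũ₀ (ν * t) x)‖ₑ ^ (6 : ℝ) ≤ ((K6 : ℝ≥0∞) * D ^ (1 / 2 : ℝ)) ^ (6 : ℝ) := by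
        have e : eLpNorm (fun x => (u t x - heatFlow ũ₀ (ν * t) x)) 6 volume ^ ((6 : ℝ≥0) : ℝ) = ∫⁻ x, ‖(u t x - heatFlow ũ₀ (ν * t) x)‖ₑ ^ ((6 : ℝ≥0) : ℝ) :=
          eLpNorm_nnreal_pow_eq_lintegral (by norm_num)
        have e' : (∫⁻ x, ‖(u t x - heatFlow ũ₀ (ν * t) x)‖ₑ ^ (6 : ℝ)) = eLpNorm (fun x => (u t x - heatFlow ũ₀ (ν * t) x)) 6 volume ^ (6 : ℝ) := by
          have : ((6 : ℝ≥0) : ℝ) = 6 := by norm_num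
          rw [this] at e
          exact e.symm
        rw [e']
        exact ENNReal.rpow_le_rpow h6 (by norm_num)
      calc ∫⁻ x, ‖(u t x - heatFlow ũ₀ (ν * t) x)‖ₑ ^ (3 : ℝ)
          ≤ (∫⁻ x, ‖(u t x - heatFlow ũ₀ (ν * t) x)‖ₑ ^ (2 : ℝ)) ^ (3 / 4 : ℝ) * (∫⁻ x, ‖(u t x - heatFlow ũ₀ (ν * t) x)‖ₑ ^ (6 : ℝ)) ^ (1 / 4 : ℝ) :=
            lintegral_enorm_cube_le_interp hw_t
        _ ≤ (ENNReal.ofReal Kst) ^ (3 / 4 : ℝ) * (((K6 : ℝ≥0∞) * D ^ (1 / 2 : ℝ)) ^ (6 : ℝ)) ^ (1 / 4 : ℝ) :=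
            mul_le_mul' (ENNReal.rpow_le_rpow h2 (by norm_num)) (ENNReal.rpow_le_rpow h6' (by norm_num))
        _ = C₀ * D ^ (3 / 4 : ℝ) := by
            rw [← ENNReal.rpow_mul, ENNReal.mul_rpow_of_nonneg _ _ (by norm_num), ← ENNReal.rpow_mul, hC₀]
            norm_num
            ring
        _ ≤ C₀ * (1 + D) := mul_le_mul_right (rpow_threeQuarters_le_one_add' D) _
    -- measurability on the strip `(0, S)`
    have hwS : AEMeasurable (fun z : ℝ × (EuclideanSpace ℝ (Fin 3)) => ‖(u z.1 z.2 - heatFlow ũ₀ (ν * z.1) z.2)‖ₑ ^ (3 : ℝ)) ((volume.restrict (Ioo 0 S)).prod (volume : Measure (EuclideanSpace ℝ (Fin 3)))) := by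
      rw [← hprodS]
      exact (hwm.mono_measure (Measure.restrict_mono (prod_mono (Ioo_subset_Ioo_right hST.le) Subset.rfl)
        le_rfl)).enorm.pow_const _
    obtain ⟨-, hFm⟩ := integrableOn_frobeniusNormSq_sub_fderiv_heatFlow_box (ρ := 1) (a' := S / 2) (b' := S / 2)
      hν hM'0 hMb hũ₀3 hG hG2 (by positivity) (by linarith)
    have hFS : AEMeasurable (fun z : ℝ × (EuclideanSpace ℝ (Fin 3)) => ENNReal.ofReal (frobeniusNormSq (G z.1 z.2 - fderiv ℝ (heatFlow ũ₀ (ν * z.1)) z.2))) ((volume.restrict (Ioo 0 S)).prod (volume : Measure (EuclideanSpace ℝ (Fin 3)))) := by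
      rw [← hprodS]; exact hFm.aemeasurable.ennreal_ofReal
    calc ∫⁻ z in Ioo 0 S ×ˢ (univ : Set (EuclideanSpace ℝ (Fin 3))), ‖(u z.1 z.2 - heatFlow ũ₀ (ν * z.1) z.2)‖ₑ ^ (3 : ℝ)
        = ∫⁻ t in Ioo 0 S, ∫⁻ x, ‖(u t x - heatFlow ũ₀ (ν * t) x)‖ₑ ^ (3 : ℝ) := by rw [hprodS, lintegral_prod _ hwS]
      _ ≤ ∫⁻ t in Ioo 0 S, C₀ * (1 + ∫⁻ x, ENNReal.ofReal (frobeniusNormSq (G t x - fderiv ℝ (heatFlow ũ₀ (ν * t)) x))) := lintegral_mono_ae hx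
      _ = C₀ * (volume (Ioo 0 S) + ∫⁻ t in Ioo 0 S, ∫⁻ x, ENNReal.ofReal (frobeniusNormSq (G t x - fderiv ℝ (heatFlow ũ₀ (ν * t)) x))) := by
          rw [lintegral_const_mul' _ _ hC₀top, lintegral_add_left' aemeasurable_const, lintegral_const,
            Measure.restrict_apply_univ, one_mul]
      _ = C₀ * (volume (Ioo 0 S) + ∫⁻ z in Ioo 0 S ×ˢ (univ : Set (EuclideanSpace ℝ (Fin 3))), ENNReal.ofReal (frobeniusNormSq (G z.1 z.2 - fderiv ℝ (heatFlow ũ₀ (ν * z.1)) z.2))) := by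
          rw [hprodS, lintegral_prod _ hFS]
      _ ≤ C₀ * (ENNReal.ofReal T + ENNReal.ofReal (Kst / ν)) := by
          refine mul_le_mul_right (add_le_add ?_ hDS) _
          rw [Real.volume_Ioo]; exact ENNReal.ofReal_le_ofReal (by linarith)
  -- ### union over `S ↑ T`
  have hwT : ∫⁻ z in Ioo 0 T ×ˢ (univ : Set (EuclideanSpace ℝ (Fin 3))), ‖(u z.1 z.2 - heatFlow ũ₀ (ν * z.1) z.2)‖ₑ ^ (3 : ℝ) ≤ C₀ * (ENNReal.ofReal T + ENNReal.ofReal (Kst / ν)) := by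
    set Sn : ℕ → ℝ := fun n => T * (((n : ℝ) + 1) / ((n : ℝ) + 2)) with hSn
    have hSn0 : ∀ n, 0 < Sn n := fun n => by positivity
    have hSnT : ∀ n, Sn n < T := fun n => by
      rw [hSn]; dsimp only
      have : ((n : ℝ) + 1) / ((n : ℝ) + 2) < 1 := by rw [div_lt_one (by positivity)]; linarith
      nlinarith
    have hmono : Monotone Sn := fun m n hmn => by
      rw [hSn]; dsimp only
      refine mul_le_mul_of_nonneg_left ?_ hT.le
      rw [div_le_div_iff₀ (by positivity) (by positivity)]
      nlinarith [(Nat.cast_le.2 hmn : (m : ℝ) ≤ n)]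
    have hdir : Directed (· ⊆ ·) fun n : ℕ => Ioo 0 (Sn n) ×ˢ (univ : Set (EuclideanSpace ℝ (Fin 3))) :=
      Monotone.directed_le fun m n hmn => prod_mono (Ioo_subset_Ioo_right (hmono hmn)) Subset.rfl
    have hU : (⋃ n : ℕ, Ioo 0 (Sn n) ×ˢ (univ : Set (EuclideanSpace ℝ (Fin 3)))) = Ioo 0 T ×ˢ (univ : Set (EuclideanSpace ℝ (Fin 3))) := by
      rw [← iUnion_prod_const]
      congr 1
      refine subset_antisymm (iUnion_subset fun n => Ioo_subset_Ioo_right (hSnT n).le) fun r hr => ?_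
      obtain ⟨n, hn⟩ := exists_nat_gt (r / (T - r))
      refine mem_iUnion.2 ⟨n, ⟨hr.1, ?_⟩⟩
      rw [hSn]; dsimp only
      rw [div_lt_iff₀ (by linarith [hr.2])] at hn
      rw [mul_div_assoc', lt_div_iff₀ (by positivity)]
      nlinarith [hr.1, hr.2]
    rw [← hU, setLIntegral_iUnion_of_directed _ hdir]
    exact iSup_le fun n => perS (Sn n) (hSn0 n) (hSnT n)
  -- ### `u = e + w`
  have hsplit : ∀ z : ℝ × (EuclideanSpace ℝ (Fin 3)), ‖u z.1 z.2‖ₑ ^ (3 : ℝ) ≤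
      4 * (‖heatFlow ũ₀ (ν * z.1) z.2‖ₑ ^ (3 : ℝ) + ‖(u z.1 z.2 - heatFlow ũ₀ (ν * z.1) z.2)‖ₑ ^ (3 : ℝ)) := by
    intro z
    have htri : ‖u z.1 z.2‖ₑ ≤ ‖heatFlow ũ₀ (ν * z.1) z.2‖ₑ + ‖(u z.1 z.2 - heatFlow ũ₀ (ν * z.1) z.2)‖ₑ := by
      calc ‖u z.1 z.2‖ₑ = ‖heatFlow ũ₀ (ν * z.1) z.2 + (u z.1 z.2 - heatFlow ũ₀ (ν * z.1) z.2)‖ₑ := by rw [add_sub_cancel]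
        _ ≤ _ := enorm_add_le _ _
    calc ‖u z.1 z.2‖ₑ ^ (3 : ℝ) ≤ (‖heatFlow ũ₀ (ν * z.1) z.2‖ₑ + ‖(u z.1 z.2 - heatFlow ũ₀ (ν * z.1) z.2)‖ₑ) ^ (3 : ℝ) :=
          ENNReal.rpow_le_rpow htri (by norm_num)
      _ ≤ 2 ^ ((3 : ℝ) - 1) * (‖heatFlow ũ₀ (ν * z.1) z.2‖ₑ ^ (3 : ℝ) + ‖(u z.1 z.2 - heatFlow ũ₀ (ν * z.1) z.2)‖ₑ ^ (3 : ℝ)) :=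
          ENNReal.rpow_add_le_mul_rpow_add_rpow _ _ (by norm_num)
      _ = 4 * (‖heatFlow ũ₀ (ν * z.1) z.2‖ₑ ^ (3 : ℝ) + ‖(u z.1 z.2 - heatFlow ũ₀ (ν * z.1) z.2)‖ₑ ^ (3 : ℝ)) := by
          congr 1
          rw [show (3 : ℝ) - 1 = (2 : ℕ) by norm_num, ENNReal.rpow_natCast]
          norm_num
  have he_fin : ∫⁻ z in Ioo 0 T ×ˢ (univ : Set (EuclideanSpace ℝ (Fin 3))), ‖heatFlow ũ₀ (ν * z.1) z.2‖ₑ ^ (3 : ℝ) < ∞ :=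
    he3b.trans_lt (ENNReal.mul_lt_top ENNReal.ofReal_lt_top
      (ENNReal.rpow_lt_top_of_nonneg (by norm_num) hũ₀3.eLpNorm_ne_top))
  calc ∫⁻ z in Ioo 0 T ×ˢ (univ : Set (EuclideanSpace ℝ (Fin 3))), ‖u z.1 z.2‖ₑ ^ (3 : ℝ)
      ≤ ∫⁻ z in Ioo 0 T ×ˢ (univ : Set (EuclideanSpace ℝ (Fin 3))), 4 * (‖heatFlow ũ₀ (ν * z.1) z.2‖ₑ ^ (3 : ℝ) + ‖(u z.1 z.2 - heatFlow ũ₀ (ν * z.1) z.2)‖ₑ ^ (3 : ℝ)) :=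
        lintegral_mono fun z => hsplit z
    _ = 4 * ((∫⁻ z in Ioo 0 T ×ˢ (univ : Set (EuclideanSpace ℝ (Fin 3))), ‖heatFlow ũ₀ (ν * z.1) z.2‖ₑ ^ (3 : ℝ)) +
          ∫⁻ z in Ioo 0 T ×ˢ (univ : Set (EuclideanSpace ℝ (Fin 3))), ‖(u z.1 z.2 - heatFlow ũ₀ (ν * z.1) z.2)‖ₑ ^ (3 : ℝ)) := by
        rw [lintegral_const_mul' _ _ (by norm_num), lintegral_add_left' (hem.enorm.pow_const _)]
    _ < ∞ := by
        refine ENNReal.mul_lt_top (by norm_num) (ENNReal.add_lt_top.2 ⟨he_fin, hwT.trans_lt ?_⟩)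
        exact ENNReal.mul_lt_top hC₀top.lt_top (ENNReal.add_lt_top.2 ⟨ENNReal.ofReal_lt_top, ENNReal.ofReal_lt_top⟩)

end Main

end Literature.Analysis.FluidPDE

end
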